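import Summits.HodgeConjecture.HodgeConjecture.Theorems.Ring2AbelianAllAndreDominatedPencils
import Summits.HodgeConjecture.HodgeConjecture.Theorems.Ring2AbelianAllAndreFibreProductPencils
import Summits.HodgeConjecture.HodgeConjecture.Theorems.Ring2AbelianAllAndreFibreClassConstancyHolds
import Summits.HodgeConjecture.HodgeConjecture.Theorems.Ring2AbelianAllAndreFibreClassExtremeDegrees
import Summits.HodgeConjecture.HodgeConjecture.Theorems.Ring2AbelianAllAndreCorrespondenceCategory
import Summits.HodgeConjecture.HodgeConjecture.Theorems.Ring2HypothesesDescentLefschetzBRungsNested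
import HarnessLib

/-!
# Ring 2 hypotheses, descent face — THE FIBRE-CLASS LEFSCHETZ NODE (β′) DESCENDS ALONG `S`-RETRACTS OF COMPACT PENCILS,
# hence its rungs are NESTED (`(β′)_{r+d} ⟹ (β′)_d`), (β′) equals each of its tails, and (β′) / (β∀′) are equivalent to
# their restrictions to FIBRE SQUARES — unconditionally, with EXACT scalars

research route conditional on HC_CM; not a corollary; Q11.4-sentence-2 already refuted in dim ≥ 3.
Cell `pub-hodge-ring2` (Hodge ladder STAGE 3), seat `ring2-b05` (binder row b05
`Ring2.Hypotheses.MotivatedImpliesAlgebraicAV`, published modulo X = `Ring2.AbelianAll.LefschetzBCompactPencils`), gen 44,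
first file. `HC_CM` (`Theses.RankFourFaces.CMAbelianHodge`) occurs ONLY as the displayed binder `hCM` of the last row,
never restated; nothing here proves a case of the Hodge conjecture; no binder is discharged; X, the β-nodes
`FibreClassLefschetzOn[CMPointed|Compact]Pencils`, their rungs `(β′)_d` and row b05 stay OPEN and are displayed as
hypotheses only.

THE OBSERVATION. Gen 43 nested the rungs of X = (5∀) and of (5) DOWNWARD by padding a pencil `f : 𝒳 ⟶ S` with an abelian
`r`-fold `B` and descending `B⋆` along the surjection `B × 𝒳 ⟶ 𝒳`; it left the β-column («(β′)_d nesting via the Gysin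
padding `pr_! ∘ T ∘ σ_!` … algebraicity of the composite correspondence») open, because on the carriers every clean base
change holds only UP TO A SCALAR depending on the fibre (`complexGysin_cleanBaseChange`), and the node
`FibreClassLefschetzOn hf` asks for an EXACT identity `j_s^* T (j_{t*} j_t^* W) = j_s^* W` for all `t, s` at once. The way
out is to pad by PULL-BACKS, not by Gysin maps. For any `S`-retract `𝒳 ⟶σ 𝒴 ⟶π 𝒳` (`σ ≫ π = 𝟙`) of compact pencils
`f`, `π ≫ f` of abelian varieties and an algebraic correspondence `T'` of `𝒴` inverting `∪[𝒴_t]` on fibre restrictions,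

  `T := c⁻¹ · σ^* ∘ T' ∘ π^*`

inverts `∪[𝒳_t]` on fibre restrictions, where `c` is THE scalar of the ONE base change that occurs,
`π^*(j_{t*} x) = c · J_{t*}(π_t^* x)` (the cartesian square `𝒴_t ⟶ 𝒴` over `𝒳_t ⟶ 𝒳`, Fulton Thm. 6.2 (a) on the
carriers): `c` does NOT depend on `t`, because in degree `0` the identity reads `π^*[𝒳_t] = c · [𝒴_t]` and BOTH fibre
classes are independent of `t` — the tree's theorem (φ) `fibreClassConstantOn_holds` (ab-andre-2 XIII-e, Fulton 19.1.1 /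
Ehresmann) — with `[𝒴_t] ≠ 0` (`fiberGysin_one_ne_zero`); and `c ≠ 0` since `σ^* π^* = 𝟙` and `[𝒳_t] ≠ 0`. Every other
step is an exact functoriality: `π_t^* j_t^* = J_t^* π^*`, `j_s^* σ^* = σ_s^* J_s^*`, `σ_s ≫ π_s = 𝟙` (ab-andre-2 XXXIII-a
`exists_fiberSlice`, `fiberSlice_comp_fiberOverMap`), and pull-backs / composites / scalar multiples of algebraic
correspondences are algebraic correspondences (`isAlgebraicCorrespondence_map`, `IsAlgebraicCorrespondence.comp/.smul`).

* §1 `exists_map_complexGysin_fiberι_eq_smul_of_over` (the base change at one fibre, any `S`-morphism `π : 𝒴 ⟶ 𝒳` of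
  compact pencils), **`exists_map_fiberGysin_eq_smul_of_over` — ONE scalar for ALL fibres** (by (φ) twice).
* §2 **`fibreClassLefschetzOn_of_retract` — (β′) DESCENDS ALONG EVERY `S`-RETRACT** (`d ≤ d'`); instances: the product
  pencil `B × 𝒳 ⟶ S` (`fibreClassLefschetzOn_of_snd_comp`), the fibre product `𝒴 ×_S 𝒳 ⟶ S` with another compact pencil
  (`fibreClassLefschetzOn_of_fibreProduct`, ab-andre-2 XXXIII-b), the fibre square (`fibreClassLefschetzOn_of_square`).
* §3 **THE RUNGS OF (β′) ARE NESTED DOWNWARD: `fibreClassLefschetzOnAtRelDim_of_add` — `(β′)_{r+d} ⟹ (β′)_d`** (pad with a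
  CM abelian `r`-fold, `exists_isOfCMType_dim_eq_succ`), `fibreClassLefschetzOnAtRelDim_anti`,
  **`fibreClassLefschetzOnCMPointedPencils_iff_forall_le` — (β′) ⟺ `∀ d ≥ d₀, (β′)_d` for every `d₀`**,
  `fibreClassLefschetzOnCMPointedPencils_iff_frequently` — (β′) ⟺ its rungs hold for a COFINAL set of `d`;
  the all-pencil node padded: `fibreClassLefschetzOnCompactPencils_of_forall_add`.
* §4 **(β′) and (β∀′) ARE THEIR RESTRICTIONS TO FIBRE SQUARES** (`…_iff_squares`; ab-andre-2 XXXIII-c did this for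
  (L), (L∀), (4), (2), (3)); the cell row with an arbitrary β-tail:
  `hodgeAbelianVarieties_of_HC_CM_of_forall_le_fibreClassLefschetzOnAtRelDim` — `HC_CM ∧ [∀ d ≥ d₀, (β′)_d] ⟹ HC_AV`
  modulo Lemme 6.3.1 (c11) only, `HC_CM` BY NAME, load-bearing.

HONEST COLUMN. No definition, no named fact, no sorry; (κ), (φ) are tree theorems, not hypotheses. Nothing is discharged:
nesting runs DOWNWARD only; the UPWARD direction `(β′)_d ⟹ (β′)_{d+1}`, (β′) for any non-isotrivial-type pencil, and
descent of (β′) along finite étale base change are NOT claimed. The companion file (gen 44, second) treats the other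
functoriality: (β′) descends along dominant equidimensional `S`-morphisms (fibrewise isogenies).
References: Abdulali1994FamiliesAV (Conj. 5.3, Thm. 5.5 p. 1130); Andre1996Motifs (§6.3 Remarque 2 p. 33, Lemme 6.3.1 p. 31);
Fulton1998 (Prop. 1.7, Thm. 6.2 (a), §19.1 Prop. 19.1.1, §16.1 Prop. 16.1.1); FultonYoungTableaux1997 (App. B §B.1 (1)–(6));
BrosnanFangNiePearlstein2009 (§6 Lemma 48: the padding `X ↦ B × X`); MumfordGIT (Thm. 6.14); VoisinHodgeII2003 (Prop. 9.21).
-/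

noncomputable section

-- every declaration of this problem lives in `Summit.HodgeConjecture.HodgeConjecture.…` (summit = sub-problem)
set_option linter.dupNamespace false

open CategoryTheory CategoryTheory.Limits AlgebraicGeometry MonoidalCategory CartesianMonoidalCategory
open Literature.AlgebraicGeometry Literature.AlgebraicGeometry.Motives Literature.AlgebraicGeometry.HodgeTheory
open Literature.AlgebraicTopology.SingularHomology (singularCohomology)
open Literature.AlgebraicGeometry.Milne1999 (IsOfCMType)
open Literature.AlgebraicGeometry.Deligne1982 (cmLocus)
open Literature.AlgebraicGeometry.Andre1996 (andre1996_cmAnchoredPencil)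
open Summit.HodgeConjecture.HodgeConjecture.Ring2.AbelianAll

namespace Summit.HodgeConjecture.HodgeConjecture.Theorems

variable {d d' : ℕ} {𝒳 𝒴 S : SchemeOver ℂ} {f : 𝒳 ⟶ S} {π : 𝒴 ⟶ 𝒳}

/-! ## §1 The one base change: `π^* j_{t*} = c · J_{t*} π_t^*`, with ONE scalar for all fibres -/

/-- `(q, p) : W ⟶ Y ⊗ X'` is a closed immersion as soon as `p` is one and `Y` is smooth projective (hence separated):
`(q, p) ≫ snd = p` with `snd` separated (the mirror image of the tree's `isClosedImmersion_lift_left_of_isSmoothProjective`).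
[cite: Fulton1998, Prop. 1.7 and §16.1] -/
theorem isClosedImmersion_lift_right_of_isSmoothProjective {m : ℕ} {Y X' W : SchemeOver ℂ} (hY : IsSmoothProjective m Y)
    (q : W ⟶ Y) (p : W ⟶ X') [IsClosedImmersion p.left] : IsClosedImmersion (lift q p).left := by
  haveI := isClosedImmersion_lift_left_of_isSmoothProjective hY p q
  haveI : IsIso (β_ X' Y).hom.left :=
    ⟨⟨(β_ X' Y).inv.left, by rw [← Over.comp_left, Iso.hom_inv_id]; rfl, by rw [← Over.comp_left, Iso.inv_hom_id]; rfl⟩⟩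
  rw [← lift_braiding_hom p q, Over.comp_left]
  infer_instance

/-- **Base change at one fibre, for an `S`-morphism of compact pencils.** Let `f : 𝒳 ⟶ S` and `π ≫ f : 𝒴 ⟶ S` be compact
pencils of abelian varieties of relative dimensions `d`, `d'` (`π : 𝒴 ⟶ 𝒳` any `S`-morphism). The square `𝒴_t ⟶ 𝒴` over
`𝒳_t ⟶ 𝒳` (fibre inclusions `J_t`, `j_t`; left edge the fibre map `π_t`, right edge `π`) is cartesian of the expected
dimensions `d' + (d + 1) = d + (d' + 1)`, so for the complex orientations there is ONE scalar `c` with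
`π^*(j_{t*} x) = c · J_{t*}(π_t^* x)` for all `x ∈ Hᵃ(𝒳_t(ℂ); ℂ)` and all `a` — the tree's PROVED clean base change
`complexGysin_cleanBaseChange` (Fulton Thm. 6.2 (a)), the incidence being ab-andre-2's `retract_proj_incidence`.
[cite: Fulton1998, Thm. 6.2 (a) and Prop. 1.7] [cite: FultonYoungTableaux1997, Appendix B §B.1 (5)] -/
theorem exists_map_complexGysin_fiberι_eq_smul_of_over (hf : IsCompactAbelianPencil f d)
    (hF : IsCompactAbelianPencil (π ≫ f) d') (t : ComplexPoints S) :
    ∃ c : ℂ, ∀ ⦃a b : ℕ⦄ (hab : a + 2 * (d + 1) = b + 2 * d) (x : complexBetti (fiberOver f t) a),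
      complexBetti.map π b
          (complexGysin complexOrientationFamily (hf.isSmoothProjective_fiberOver t) hf.isSmoothProjective_total
            (fiberι f t) hab x) =
        c • complexGysin complexOrientationFamily (hF.isSmoothProjective_fiberOver t) hF.isSmoothProjective_total
          (fiberι (π ≫ f) t) (show a + 2 * (d' + 1) = b + 2 * d' by omega)
          (complexBetti.map (fiberOverMap π f t) a x) := by
  haveI : IsProper S.hom := IsSmoothProjective.isProper_holds hf.isSmoothProjective_base
  haveI : IsClosedImmersion (fiberι (π ≫ f) t).left := Motives.isClosedImmersion_fiberι_left (π ≫ f) t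
  haveI := isClosedImmersion_lift_right_of_isSmoothProjective (hf.isSmoothProjective_fiberOver t)
    (fiberOverMap π f t) (fiberι (π ≫ f) t)
  exact complexGysin_cleanBaseChange complexOrientationFamily (hf.isSmoothProjective_fiberOver t)
    hf.isSmoothProjective_total hF.isSmoothProjective_total (hF.isSmoothProjective_fiberOver t) (fiberι f t) π
    (fiberOverMap π f t) (fiberι (π ≫ f) t) (by omega) fun P Q hPQ ↦ by
      obtain ⟨R, h₁, h₂⟩ := retract_proj_incidence f π t Q P hPQ.symm
      exact ⟨R, h₂, h₁⟩

/-- **ONE SCALAR FOR ALL FIBRES: `π^*(j_{t*} x) = c · J_{t*}(π_t^* x)` for every `t`, `p`, `x ∈ H²ᵖ(𝒳_t(ℂ); ℂ)`** (written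
with the tree's `fiberGysin`). In degree `0` the base change of a fibre `t` reads `π^*[𝒳_t] = c_t · [𝒴_t]`; both fibre classes
are independent of `t` — (φ), the tree's theorem `fibreClassConstantOn_holds` for `f` and for `π ≫ f` — and `[𝒴_t] ≠ 0`
(`fiberGysin_one_ne_zero`), so `c_t` is independent of `t`. [cite: Fulton1998, §19.1 proof of Prop. 19.1.1 and Thm. 6.2 (a)]
[cite: FultonYoungTableaux1997, Appendix B §B.1 (5)] -/
theorem exists_map_fiberGysin_eq_smul_of_over (hf : IsCompactAbelianPencil f d) (hF : IsCompactAbelianPencil (π ≫ f) d') :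
    ∃ c : ℂ, ∀ (t : ComplexPoints S) (p : ℕ) (x : complexBetti (fiberOver f t) (2 * p)),
      complexBetti.map π (2 * (p + 1)) (fiberGysin hf t p x) =
        c • fiberGysin hF t p (complexBetti.map (fiberOverMap π f t) (2 * p) x) := by
  choose c hc using exists_map_complexGysin_fiberι_eq_smul_of_over hf hF
  haveI := connectedSpace_complexPoints hf.isSmoothProjective_base
  obtain ⟨t₀⟩ : Nonempty (ComplexPoints S) := inferInstance
  -- degree `0`: `π^*[𝒳_t] = c_t · [𝒴_t]`
  have h0 : ∀ t : ComplexPoints S,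
      complexBetti.map π 2 (fiberGysin hf t 0 (singularCohomology.one ℂ (ComplexPoints (fiberOver f t)))) =
        c t • fiberGysin hF t 0 (singularCohomology.one ℂ (ComplexPoints (fiberOver (π ≫ f) t))) := fun t ↦ by
    have h := hc t (show 0 + 2 * (d + 1) = 2 + 2 * d by omega) (singularCohomology.one ℂ _)
    rw [singularCohomology.map_one] at h
    exact h
  -- hence `c_t = c_{t₀}`
  have hct : ∀ t, c t = c t₀ := fun t ↦ by
    have h := h0 t
    rw [fibreClassConstantOn_holds hf t t₀, fibreClassConstantOn_holds hF t t₀, h0 t₀] at h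
    exact (smul_left_injective ℂ (fiberGysin_one_ne_zero hF t₀) h).symm
  refine ⟨c t₀, fun t p x ↦ ?_⟩
  rw [← hct t]
  exact hc t (show 2 * p + 2 * (d + 1) = 2 * (p + 1) + 2 * d by omega) x

/-! ## §2 (β′) descends along every `S`-retract of compact pencils -/

/-- **(β′) DESCENDS ALONG `S`-RETRACTS.** Let `f : 𝒳 ⟶ S` be a compact pencil of abelian `d`-folds, `π ≫ f : 𝒴 ⟶ S` a compact
pencil of abelian `d'`-folds, `d ≤ d'`, with `σ : 𝒳 ⟶ 𝒴`, `σ ≫ π = 𝟙`. If `FibreClassLefschetzOn` holds for `π ≫ f` then it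
holds for `f`: for `p ≤ d` and `T'` the algebraic correspondence of `𝒴` in degree `p`, put `T := c⁻¹ · σ^* ∘ T' ∘ π^*` (`c` the
scalar of §1, non-zero since `σ^* π^*[𝒳_t] = [𝒳_t] ≠ 0`); then
`j_s^* T(j_{t*} j_t^* W) = c⁻¹ c · σ_s^* J_s^* T'(J_{t*} J_t^* π^* W) = σ_s^* J_s^* π^* W = σ_s^* π_s^* j_s^* W = j_s^* W`.
No named fact; (φ) enters through §1. [cite: Abdulali1994FamiliesAV, Conjecture 5.3 and Theorem 5.5 (p. 1130)]
[cite: Fulton1998, Thm. 6.2 (a) and §16.1 Prop. 16.1.1] [cite: BrosnanFangNiePearlstein2009, §6 Lemma 48] -/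
theorem fibreClassLefschetzOn_of_retract (hf : IsCompactAbelianPencil f d) {σ : 𝒳 ⟶ 𝒴}
    (hF : IsCompactAbelianPencil (π ≫ f) d') (hσπ : σ ≫ π = 𝟙 𝒳) (hdd' : d ≤ d') (h : FibreClassLefschetzOn hF) :
    FibreClassLefschetzOn hf := by
  haveI : IsProper S.hom := IsSmoothProjective.isProper_holds hf.isSmoothProjective_base
  obtain ⟨c, hc⟩ := exists_map_fiberGysin_eq_smul_of_over hf hF
  -- `σ^* π^* = 𝟙`
  have hσπ' : ∀ (k : ℕ) (u : complexBetti 𝒳 k), complexBetti.map σ k (complexBetti.map π k u) = u := fun k u ↦ by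
    rw [← complexBetti.map_comp_apply', hσπ, complexBetti.map_id]
    rfl
  -- `c ≠ 0`
  have hc0 : c ≠ 0 := by
    haveI := connectedSpace_complexPoints hf.isSmoothProjective_base
    obtain ⟨t⟩ : Nonempty (ComplexPoints S) := inferInstance
    intro h0
    apply fiberGysin_one_ne_zero hf t
    have h1 := hc t 0 (singularCohomology.one ℂ _)
    rw [h0, zero_smul] at h1
    rw [← hσπ' _ (fiberGysin hf t 0 _), h1, map_zero]
  intro p hp
  obtain ⟨T', hT'alg, hT'id⟩ := h p (hp.trans hdd')
  refine ⟨c⁻¹ • ((complexBetti.map σ (2 * p)).hom ∘ₗ T' ∘ₗ (complexBetti.map π (2 * (p + 1))).hom), ?_, fun W t s ↦ ?_⟩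
  · -- algebraicity: pull-backs, composites and scalar multiples of algebraic correspondences
    refine IsAlgebraicCorrespondence.smul hf.isSmoothProjective_total hf.isSmoothProjective_total ?_ _
    refine IsAlgebraicCorrespondence.comp hf.isSmoothProjective_total hF.isSmoothProjective_total
      hf.isSmoothProjective_total ?_ (isAlgebraicCorrespondence_map hf.isSmoothProjective_total hF.isSmoothProjective_total
        σ (by omega)) (by omega)
    exact IsAlgebraicCorrespondence.comp hF.isSmoothProjective_total hF.isSmoothProjective_total
      hf.isSmoothProjective_total (isAlgebraicCorrespondence_map hF.isSmoothProjective_total hf.isSmoothProjective_total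
        π (by omega)) hT'alg (by omega)
  · obtain ⟨σs, hσs⟩ := exists_fiberSlice f hσπ s
    have hσsπs := fiberSlice_comp_fiberOverMap f hσπ s hσs
    -- `π^* (j_{t*} j_t^* W) = c · J_{t*} J_t^* (π^* W)`
    have h1 : complexBetti.map π (2 * (p + 1)) (fiberGysin hf t p (complexBetti.map (fiberι f t) (2 * p) W)) =
        c • fiberGysin hF t p (complexBetti.map (fiberι (π ≫ f) t) (2 * p) (complexBetti.map π (2 * p) W)) := by
      rw [hc t p, ← complexBetti.map_comp_apply' (fiberOverMap π f t) (fiberι f t), fiberOverMap_comp_fiberι,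
        complexBetti.map_comp_apply' (fiberι (π ≫ f) t) π]
    -- `j_s^* σ^* = σ_s^* J_s^*`
    have h2 : ∀ u : complexBetti 𝒴 (2 * p), complexBetti.map (fiberι f s) (2 * p) (complexBetti.map σ (2 * p) u) =
        complexBetti.map σs (2 * p) (complexBetti.map (fiberι (π ≫ f) s) (2 * p) u) := fun u ↦ by
      rw [← complexBetti.map_comp_apply' (fiberι f s) σ, ← hσs, complexBetti.map_comp_apply' σs (fiberι (π ≫ f) s)]
    -- `σ_s^* J_s^* π^* = j_s^*`
    have h3 : complexBetti.map σs (2 * p) (complexBetti.map (fiberι (π ≫ f) s) (2 * p) (complexBetti.map π (2 * p) W)) =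
        complexBetti.map (fiberι f s) (2 * p) W := by
      rw [← complexBetti.map_comp_apply' (fiberι (π ≫ f) s) π, ← fiberOverMap_comp_fiberι,
        complexBetti.map_comp_apply' (fiberOverMap π f s) (fiberι f s),
        ← complexBetti.map_comp_apply' σs (fiberOverMap π f s), hσsπs, complexBetti.map_id]
      rfl
    change complexBetti.map (fiberι f s) (2 * p) (c⁻¹ • complexBetti.map σ (2 * p)
      (T' (complexBetti.map π (2 * (p + 1)) (fiberGysin hf t p (complexBetti.map (fiberι f t) (2 * p) W))))) = _
    rw [map_smul, h2, h1, map_smul, map_smul, hT'id, map_smul, h3, smul_smul, inv_mul_cancel₀ hc0, one_smul]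

/-- **(β′) for `f` from (β′) for the PRODUCT PENCIL `B × 𝒳 ⟶ S`** (`B` any complex abelian variety; the retract
`σ = (0_B, 𝟙)`, `π = pr_𝒳`; ab-andre-2 XXXII-a `isCompactAbelianPencil_snd_comp`). The hypothesis is NOT asserted.
[cite: BrosnanFangNiePearlstein2009, §6 Lemma 48] [cite: Abdulali1994FamiliesAV, Conjecture 5.3 (p. 1130)] -/
theorem fibreClassLefschetzOn_of_snd_comp (hf : IsCompactAbelianPencil f d) (B : AbelianVariety ℂ)
    (h : FibreClassLefschetzOn (isCompactAbelianPencil_snd_comp hf B)) : FibreClassLefschetzOn hf :=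
  fibreClassLefschetzOn_of_retract hf (σ := lift (toSpecOver 𝒳 ≫ (1 : B.Points ℂ)) (𝟙 𝒳))
    (isCompactAbelianPencil_snd_comp hf B) (lift_snd _ _) (Nat.le_add_left d B.dim) h

/-- **(β′) for `f` from (β′) for the FIBRE PRODUCT `𝒴 ×_S 𝒳 ⟶ S`** with any other compact pencil `g : 𝒴 ⟶ S` of abelian
varieties over the same curve (ab-andre-2 XXXIII-b: a compact pencil of relative dimension `d' + d`, retracting onto `𝒳`
through the zero section of `g`). The hypothesis is NOT asserted. [cite: MumfordGIT, Thm. 6.14]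
[cite: Abdulali1994FamiliesAV, Conjecture 5.3 (p. 1130)] -/
theorem fibreClassLefschetzOn_of_fibreProduct {g : 𝒴 ⟶ S} (hg : IsCompactAbelianPencil g d') (hf : IsCompactAbelianPencil f d)
    (h : FibreClassLefschetzOn (isCompactAbelianPencil_familyPullback_snd_comp hg hf)) : FibreClassLefschetzOn hf := by
  obtain ⟨σ, hσ⟩ := exists_section_familyPullback_snd_of_pencil hg f
  exact fibreClassLefschetzOn_of_retract hf (isCompactAbelianPencil_familyPullback_snd_comp hg hf) hσ
    (Nat.le_add_left d d') h

/-- **(β′) for `f` from (β′) for its FIBRE SQUARE `𝒳 ×_S 𝒳 ⟶ S`** (relative dimension `d + d`). The hypothesis is NOT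
asserted. [cite: MumfordGIT, Thm. 6.14] [cite: Abdulali1994FamiliesAV, Conjecture 5.3 (p. 1130)] -/
theorem fibreClassLefschetzOn_of_square (hf : IsCompactAbelianPencil f d)
    (h : FibreClassLefschetzOn (isCompactAbelianPencil_square hf (rfl : d + d = d + d))) : FibreClassLefschetzOn hf :=
  fibreClassLefschetzOn_of_fibreProduct hf hf h

/-! ## §3 The rungs of (β′) are nested downward; (β′) equals each of its tails -/

/-- **`(β′)_{r+d} ⟹ (β′)_d`**: pad every CM-pointed compact pencil of abelian `d`-folds with a CM abelian `r`-fold `B` (which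
exists: `exists_isOfCMType_dim_eq_succ`; `r = 0` is trivial) — the product pencil is CM-pointed
(`cmLocus_subset_cmLocus_snd_comp`) — and descend along the retract `B × 𝒳 ⟶ 𝒳` (§2).
[cite: Andre1996Motifs, §6.3 Remarque 2 (p. 33) and Lemme 6.3.1 (ii) (p. 31)] [cite: Milne1999, §2 (p. 54)] -/
theorem fibreClassLefschetzOnAtRelDim_of_add (d r : ℕ) (h : FibreClassLefschetzOnAtRelDim (r + d)) :
    FibreClassLefschetzOnAtRelDim d := by
  intro 𝒳 S f hf hcm
  rcases r with _ | r'
  · exact (Nat.zero_add d ▸ h) hf hcm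
  · obtain ⟨B, hB, hBcm⟩ := exists_isOfCMType_dim_eq_succ r'
    have hcm' : (cmLocus (snd B.X 𝒳 ≫ f) (B.dim + d)).Nonempty := hcm.mono (cmLocus_subset_cmLocus_snd_comp f B hBcm)
    have hF : IsCompactAbelianPencil (snd B.X 𝒳 ≫ f) (r' + 1 + d) := hB ▸ isCompactAbelianPencil_snd_comp hf B
    exact fibreClassLefschetzOn_of_retract hf (σ := lift (toSpecOver 𝒳 ≫ (1 : B.Points ℂ)) (𝟙 𝒳)) hF (lift_snd _ _)
      (by omega) (h hF (hB ▸ hcm'))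

/-- **The rungs of (β′) are nested downward: `d ≤ d' → (β′)_{d'} → (β′)_d`.** [cite: Andre1996Motifs, §6.3 Remarque 2 (p. 33)] -/
theorem fibreClassLefschetzOnAtRelDim_anti {d d' : ℕ} (hdd' : d ≤ d') (h : FibreClassLefschetzOnAtRelDim d') :
    FibreClassLefschetzOnAtRelDim d := by
  obtain ⟨r, rfl⟩ : ∃ r, d' = r + d := ⟨d' - d, by omega⟩
  exact fibreClassLefschetzOnAtRelDim_of_add d r h

/-- **(β′) = `FibreClassLefschetzOnCMPointedPencils` IS EQUIVALENT TO EACH OF ITS TAILS `∀ d ≥ d₀, (β′)_d`, for every `d₀`,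
UNCONDITIONALLY** (the tree had only the conjunction over all `d`, `fibreClassLefschetzOnCMPointedPencils_iff_forall_atRelDim`,
and the rungs `d ≤ 1` as theorems). [cite: Andre1996Motifs, §6.3 Remarque 2 (p. 33)] [cite: Abdulali1994FamiliesAV, Conjecture 5.3 (p. 1130)] -/
theorem fibreClassLefschetzOnCMPointedPencils_iff_forall_le (d₀ : ℕ) :
    FibreClassLefschetzOnCMPointedPencils ↔ ∀ d : ℕ, d₀ ≤ d → FibreClassLefschetzOnAtRelDim d := by
  refine fibreClassLefschetzOnCMPointedPencils_iff_forall_atRelDim.trans ⟨fun h d _ ↦ h d, fun h d ↦ ?_⟩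
  rcases Nat.lt_or_ge d d₀ with hd | hd
  · exact fibreClassLefschetzOnAtRelDim_anti hd.le (h d₀ le_rfl)
  · exact h d hd

/-- **(β′) holds iff its rungs hold for a COFINAL set of relative dimensions** (a rung carries every lower one).
[cite: Andre1996Motifs, §6.3 Remarque 2 (p. 33)] -/
theorem fibreClassLefschetzOnCMPointedPencils_iff_frequently :
    FibreClassLefschetzOnCMPointedPencils ↔ ∀ N : ℕ, ∃ d, N ≤ d ∧ FibreClassLefschetzOnAtRelDim d := by
  refine fibreClassLefschetzOnCMPointedPencils_iff_forall_atRelDim.trans ⟨fun h N ↦ ⟨N, le_rfl, h N⟩, fun h d ↦ ?_⟩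
  obtain ⟨d', hdd', h'⟩ := h d
  exact fibreClassLefschetzOnAtRelDim_anti hdd' h'

/-- **A single rung carries all lower ones**: `(β′)_{d'} ⟹ ∀ d ≤ d', (β′)_d`. [cite: Andre1996Motifs, §6.3 Remarque 2 (p. 33)] -/
theorem forall_le_fibreClassLefschetzOnAtRelDim_of (d' : ℕ) (h : FibreClassLefschetzOnAtRelDim d') :
    ∀ d : ℕ, d ≤ d' → FibreClassLefschetzOnAtRelDim d :=
  fun _ hd ↦ fibreClassLefschetzOnAtRelDim_anti hd h

/-- **The all-pencil node padded**: (β∀′) restricted to relative dimensions `≥ d₀` already gives (β∀′) (pad with any abelian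
variety of dimension `d₀`; `exists_abelianVariety_dim_eq_succ`). [cite: Andre1996Motifs, §6.3 Remarque 2 (p. 33)]
[cite: BrosnanFangNiePearlstein2009, §6 Lemma 48] -/
theorem fibreClassLefschetzOnCompactPencils_of_forall_le (d₀ : ℕ)
    (h : ∀ ⦃n : ℕ⦄ ⦃𝒳 S : SchemeOver ℂ⦄ ⦃f : 𝒳 ⟶ S⦄ (hf : IsCompactAbelianPencil f n), d₀ ≤ n → FibreClassLefschetzOn hf) :
    FibreClassLefschetzOnCompactPencils := by
  intro d 𝒳 S f hf
  rcases d₀ with _ | r'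
  · exact h hf (Nat.zero_le d)
  · obtain ⟨B, hB⟩ := exists_abelianVariety_dim_eq_succ ℂ r'
    exact fibreClassLefschetzOn_of_snd_comp hf B (h (isCompactAbelianPencil_snd_comp hf B) (by omega))

/-! ## §4 (β′) and (β∀′) are their restrictions to fibre squares; the cell row with an arbitrary β-tail -/

/-- **(β′) ⟺ (β′) ON THE FIBRE SQUARES of the CM-pointed compact pencils** (`⟹`: the square is a CM-pointed compact pencil,
`isCompactAbelianPencil_square`, `mem_cmLocus_square`; `⟸`: §2). FACT-FREE. [cite: MumfordGIT, Thm. 6.14]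
[cite: Abdulali1994FamiliesAV, Conjecture 5.3 (p. 1130)] -/
theorem fibreClassLefschetzOnCMPointedPencils_iff_squares :
    FibreClassLefschetzOnCMPointedPencils ↔
      ∀ ⦃d : ℕ⦄ ⦃𝒳 S : SchemeOver ℂ⦄ ⦃f : 𝒳 ⟶ S⦄ (hf : IsCompactAbelianPencil f d), (cmLocus f d).Nonempty →
        FibreClassLefschetzOn (isCompactAbelianPencil_square hf (rfl : d + d = d + d)) := by
  refine ⟨fun h d 𝒳 S f hf hcm ↦ h _ ?_, fun h d 𝒳 S f hf hcm ↦ fibreClassLefschetzOn_of_square hf (h hf hcm)⟩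
  obtain ⟨t, ht⟩ := hcm
  exact ⟨t, mem_cmLocus_square f rfl ht⟩

/-- **(β∀′) ⟺ (β∀′) ON THE FIBRE SQUARES of all compact pencils.** FACT-FREE. [cite: MumfordGIT, Thm. 6.14]
[cite: Abdulali1994FamiliesAV, Conjecture 5.3 (p. 1130)] -/
theorem fibreClassLefschetzOnCompactPencils_iff_squares :
    FibreClassLefschetzOnCompactPencils ↔
      ∀ ⦃d : ℕ⦄ ⦃𝒳 S : SchemeOver ℂ⦄ ⦃f : 𝒳 ⟶ S⦄ (hf : IsCompactAbelianPencil f d),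
        FibreClassLefschetzOn (isCompactAbelianPencil_square hf (rfl : d + d = d + d)) :=
  ⟨fun h _ _ _ _ _ ↦ h _, fun h _ _ _ _ hf ↦ fibreClassLefschetzOn_of_square hf (h hf)⟩

/-- **The cell row with an ARBITRARY β-tail: `HC_CM ∧ [∀ d ≥ d₀, (β′)_d] ⟹ HC_AV` modulo Lemme 6.3.1 (c11), for every `d₀`**
(`HC_CM` BY NAME, load-bearing; the rungs below `d₀` come for free by nesting; the β-tail is weaker-or-equal than the
(5)-tail of gen 43's row through the tree's `(5)_d ⟹ (β′)_d`). research route conditional on HC_CM; not a corollary;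
Q11.4-sentence-2 already refuted in dim ≥ 3. [cite: Andre1996Motifs, Lemme 6.3.1 (p. 31) and Remarque 2 (p. 33)]
[cite: Abdulali1994FamiliesAV, Conjecture 5.3, Theorem 5.5 and Lemma 6.2 (pp. 1130–1131)] -/
theorem hodgeAbelianVarieties_of_HC_CM_of_forall_le_fibreClassLefschetzOnAtRelDim (d₀ : ℕ)
    (h₂₁ : andre1996_cmAnchoredPencil) (hCM : Theses.RankFourFaces.CMAbelianHodge)
    (hβ : ∀ d : ℕ, d₀ ≤ d → FibreClassLefschetzOnAtRelDim d) :
    Theses.PadicSemiregularLift.HodgeAbelianVarieties :=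
  HC_AV_of_HC_CM_and_fibreClassLefschetzOnCMPointedPencils h₂₁ hCM ((fibreClassLefschetzOnCMPointedPencils_iff_forall_le d₀).2 hβ)

end Summit.HodgeConjecture.HodgeConjecture.Theorems

end
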